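import Literature.Probability.LatticeModels.SourcedDoubleCurrentsSwitching
import HarnessLib

/-!
# Cluster cover for the four-point subcurrent event `𝓕_{{a,b,c,e}}`
(route ArmHyperscaling, crux `MergingFloor`, item stmt-CriticalPhenomena-15592, line
`xor-cluster-sign-bk`, registered stub `stub_clusterCover`)

Statement (`stub_clusterCover`): for a bond configuration `ω` of `ℤ^d` and four points
`a, b, c, e`, if `ω ∈ 𝓕_{{a,b,c,e}}` — i.e. `ω` contains a finite bond set `T` whose odd-degree
vertices are exactly `{a,b,c,e}` (`traceSubcurrentEvent`, ADC21 Def. 3.2 (iii) read on the trace) —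
then `a ↔ b`, or (`a ↔ c` and `b ↔ e`), or (`a ↔ e` and `b ↔ c`) in `ω`.  In the glue of the line
this is the union bound `P[𝓕_S] ≤ P[(a↔b) ∧ 𝓕_S] + P[a↔c, b↔e, a↮b] + P[a↔e, b↔c, a↮b]`.

Proof (pure combinatorics of the finite graph of `T`).  The cluster of any vertex `x` in the graph
`openGraph ↑T` contains an even number of odd-degree vertices of `T` (handshake per component, tree
`even_card_oddVertices_filter_reachable`); if `x` is itself odd, its cluster therefore contains an
odd vertex `y ≠ x` (`exists_ne_reachable_of_mem_oddVertices`).  Apply this to `a`: some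
`y ∈ {b,c,e}` is joined to `a`.  If `y = b` we are done.  If `y = c`, apply it to `b`: some
`z ∈ {a,c,e}` is joined to `b`; `z = a` or `z = c` gives `a ↔ b` (symmetry/transitivity of
reachability), `z = e` gives `a ↔ c ∧ b ↔ e`.  The case `y = e` is symmetric.  Finally reachability
in `openGraph ↑T` lifts to `openGraph ω` along `T ⊆ ω` (`openGraph_mono`, `SimpleGraph.Reachable.mono`).
The distinctness hypotheses of the registered signature are not needed by the argument.

References: M. Aizenman, H. Duminil-Copin, Ann. of Math. 194 (2021), Def. 3.2 (the event `𝓕_B`);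
H. Duminil-Copin, lecture notes (2016), §2.2.2 (sources of a current lie pairwise in common clusters).
No definitions are introduced.
-/

noncomputable section

namespace Summit.CriticalPhenomena.Ising3DConformalLimit.ArmHyperscalingMergingFloorXor

open Literature.Probability.LatticeModels Literature.Probability.Percolation

/-- **An odd vertex of a finite bond set is joined to another odd vertex.**  For a finite set of
pairs `T` and an odd-degree vertex `x` of `T`, some odd-degree vertex `y ≠ x` of `T` is reachable
from `x` in the graph of `T`: the cluster of `x` contains evenly many odd vertices
(`even_card_oddVertices_filter_reachable`) and contains `x`. (Duminil-Copin 2016, §2.2.2.) -/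
theorem exists_ne_reachable_of_mem_oddVertices {V : Type*} [DecidableEq V] (T : Finset (Sym2 V))
    {x : V} (hx : x ∈ oddVertices T) :
    ∃ y ∈ oddVertices T, y ≠ x ∧ (openGraph (↑T : Set (Sym2 V))).Reachable x y := by
  classical
  by_contra h
  push Not at h
  have heven := even_card_oddVertices_filter_reachable T x
  have hfil : (oddVertices T).filter (fun u => (openGraph (↑T : Set (Sym2 V))).Reachable x u) =
      {x} := by
    ext u
    simp only [Finset.mem_filter, Finset.mem_singleton]
    constructor
    · rintro ⟨hu, hreach⟩
      by_contra hne
      exact h u hu hne hreach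
    · rintro rfl
      exact ⟨hx, SimpleGraph.Reachable.refl _⟩
  rw [hfil, Finset.card_singleton] at heven
  exact Nat.not_even_one heven

/-- **Cluster cover** (registered stub `stub_clusterCover` of line `xor-cluster-sign-bk`): if a bond
configuration `ω` of `ℤ^d` contains a finite bond set with odd-degree vertices exactly `{a,b,c,e}`,
then `a ↔ b`, or `a ↔ c` and `b ↔ e`, or `a ↔ e` and `b ↔ c` in `ω`.  From
`exists_ne_reachable_of_mem_oddVertices` at `a` and at `b` and a case analysis, lifted to `ω` by
monotonicity of `openGraph`. (Combinatorial folklore behind ADC21 Def. 3.2 / Duminil-Copin 2016,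
§2.2.2.) -/
theorem stub_clusterCover : ∀ (d : ℕ) (ω : BondConfig (Site d)) (a b c e : Site d),
    a ≠ b → a ≠ c → a ≠ e → b ≠ c → b ≠ e → c ≠ e →
    ω ∈ traceSubcurrentEvent ({a, b, c, e} : Finset (Site d)) →
    ω ∈ openConn a b ∨ (ω ∈ openConn a c ∧ ω ∈ openConn b e) ∨ (ω ∈ openConn a e ∧ ω ∈ openConn b c) := by
  intro d ω a b c e _ _ _ _ _ _ hω
  obtain ⟨T, hTω, hTB⟩ := mem_traceSubcurrentEvent_iff.1 hω
  have hle : openGraph (↑T : Set (Sym2 (Site d))) ≤ openGraph ω := openGraph_mono hTω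
  have ha : a ∈ oddVertices T := by
    rw [hTB]; simp only [Finset.mem_insert, Finset.mem_singleton, true_or]
  have hb : b ∈ oddVertices T := by
    rw [hTB]; simp only [Finset.mem_insert, Finset.mem_singleton, true_or, or_true]
  obtain ⟨y, hy, hya, hay⟩ := exists_ne_reachable_of_mem_oddVertices T ha
  obtain ⟨z, hz, hzb, hbz⟩ := exists_ne_reachable_of_mem_oddVertices T hb
  rw [hTB] at hy hz
  simp only [Finset.mem_insert, Finset.mem_singleton] at hy hz
  have hay' : (openGraph ω).Reachable a y := hay.mono hle
  have hbz' : (openGraph ω).Reachable b z := hbz.mono hle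
  change (openGraph ω).Reachable a b ∨
    ((openGraph ω).Reachable a c ∧ (openGraph ω).Reachable b e) ∨
    ((openGraph ω).Reachable a e ∧ (openGraph ω).Reachable b c)
  rcases hy with rfl | rfl | rfl | rfl
  · exact absurd rfl hya
  · exact Or.inl hay'
  · rcases hz with rfl | rfl | rfl | rfl
    · exact Or.inl hbz'.symm
    · exact absurd rfl hzb
    · exact Or.inl (hay'.trans hbz'.symm)
    · exact Or.inr (Or.inl ⟨hay', hbz'⟩)
  · rcases hz with rfl | rfl | rfl | rfl
    · exact Or.inl hbz'.symm
    · exact absurd rfl hzb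
    · exact Or.inr (Or.inr ⟨hay', hbz'⟩)
    · exact Or.inl (hay'.trans hbz'.symm)

end Summit.CriticalPhenomena.Ising3DConformalLimit.ArmHyperscalingMergingFloorXor
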